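import Mathlib
import HarnessLib
import Summits.ResolutionOfSingularities.ResolutionOfSingularities.Theorems.WildQuotientsWildQuotientResolutionS1aQhAbsCover

/-!
# S1a — R4c cusp, brick (b6-aux): the TAIL RESIDUAL SECTION `t̂ⁿ/c` on every producer chart (residual set `V(u₀′) ∩ V(t̂)` = strict transform)

[OURS · L1 W4.5c · lead-1 g17; plan-1 RULING R-F15v (2) ★ R4c `cusp_killsIn_two`, SPEC `Cruxes/CyclicQuotientFourfolds/Lines/s1a_logminvertex-R4c-SPEC.md` §1/§2:
in the cusp assembly the producer charts `[N(x₁)]`, `[N(x₂)]` at `O` and `[N(y)]`, `[v]` at `Q` are NOT killed; the move atlas ✓`exists_moveAtlas_of_nodes` bounds the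
new formal locus on a chart by the common zeroes of its residual sections `z ∈ 𝔞·R_c` of degree `0` (`𝔞 = (aug σ_R : s^sh)`), so besides `u₀′^{n₀}/c`
(✓`QhAbs.qha_residualSection_zero`) one wants the TAIL section `t̂^{dbar/sh}/c` (`t̂ = t·T^{sh} ∈ 𝔞`, ✓`qha_tail_mem_residual`): then `F₁ ∩ O′ ⊆ V(x₀-section) ∩
V(tail-section)`, the strict transform of `S = V(x₀, t)`. Abstract setting of ✓QhAbsRoot/✓QhAbsCover (`f : Fin 3 → L`, weights `w`, tail `t ∈ 𝒥_sh`)] — NOT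
statements of the manuscript; counted 0; AI-level work, weaker than expert review. Crux stmt-ResolutionOfSingularities-17941 `CyclicQuotientFourfolds`, line
`s1a-logminvertex` v13 (`stub_reachLowerInFX`).
-/

set_option linter.dupNamespace false

noncomputable section

open Literature.AlgebraicGeometry.Resolution
open scoped LaurentPolynomial
open Summit.ResolutionOfSingularities.ResolutionOfSingularities.Theorems.WildQuotientResolution.S1
open Summit.ResolutionOfSingularities.ResolutionOfSingularities.Theorems.WildQuotientResolution.S1.CoarseChart
open Summit.ResolutionOfSingularities.ResolutionOfSingularities.Theorems.WildQuotientResolution.S1.ReesBigrading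
open Summit.ResolutionOfSingularities.ResolutionOfSingularities.Theorems.WildQuotientResolution.S1.BlowupCharts
open Summit.ResolutionOfSingularities.ResolutionOfSingularities.Theorems.WildQuotientResolution.S1.GameFrame.GModel

namespace Summit.ResolutionOfSingularities.ResolutionOfSingularities.Theorems.WildQuotientResolution.S1.KillCert.QhAbs

variable {L : Type} [CommRing L] (f : Fin 3 → L) (t : L) (w : Fin 3 → ℕ) (sh : ℕ) (ht : t ∈ (weightedFiltration f w).ideal sh)
  {m : ℕ} (mo : Fin m → ℕ) (𝒜 : (Π j : Fin m, ZMod (mo j)) → AddSubgroup L) [GradedRing 𝒜]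
  (hf0 : ∀ i, f i ∈ 𝒜 ((fun _ => (0 : Π j : Fin m, ZMod (mo j))) i)) (h𝒜t : t ∈ 𝒜 0)
  {dbar : ℕ} (y : ↥(𝒜 0)) (hy : y ∈ (traceFiltration 𝒜 f w).ideal dbar)

include hf0 h𝒜t in
/-- `t̂ⁿ` has bidegree `(sh·n, 0)` (`t̂ = t·T^{sh}`, `t` of degree `0` in the node grading). -/
theorem qha_tail_pow_mem_reesPiece (n : ℕ) :
    (⟨_, C_mul_T_mem_cobordantAlgebra _ _ ht⟩ : ↥(cobordantAlgebra f w)) ^ n ∈ reesPiece 𝒜 f w ((((sh * n : ℕ)) : ℤ), (0 : Π j : Fin m, ZMod (mo j))) := by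
  letI := reesGradedRing 𝒜 f w hf0
  have h1 : (⟨_, C_mul_T_mem_cobordantAlgebra _ _ ht⟩ : ↥(cobordantAlgebra f w)) ∈ reesPiece 𝒜 f w ((((sh : ℕ)) : ℤ), (0 : Π j : Fin m, ZMod (mo j))) :=
    mk_mem_reesPiece 𝒜 f w h𝒜t _
  have h := SetLike.pow_mem_graded n h1
  have e1 : n • ((((sh : ℕ)) : ℤ), (0 : Π j : Fin m, ZMod (mo j))) = ((((sh * n : ℕ)) : ℤ), (0 : Π j : Fin m, ZMod (mo j))) := by
    refine Prod.ext ?_ ?_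
    · change n • (((sh : ℕ) : ℤ)) = (((sh * n : ℕ)) : ℤ); rw [nsmul_eq_mul]; push_cast; ring
    · change n • (0 : Π j : Fin m, ZMod (mo j)) = 0; exact smul_zero _
  rwa [e1] at h

include hf0 h𝒜t in
/-- ★ **The tail residual section** on the chart of `c = yT^{dbar}` (`dbar = sh·n`, `n > 0`): `t̂ⁿ/c` has degree `0` and lies in `𝔞·R_c` for every ideal `𝔞 ∋ t̂`
(for the roots of R4: `𝔞 = (aug σ_R : s^sh) ∋ t̂` by ✓`qha_tail_mem_residual`). Its zero set on the chart is the strict transform of `V(t)`. [OURS · L1 W4.5c · R4c] -/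
theorem qha_residualSection_tail (n : ℕ) (hdbar : dbar = sh * n) (𝔞 : Ideal ↥(cobordantAlgebra f w))
    (h𝔞 : (⟨_, C_mul_T_mem_cobordantAlgebra _ _ ht⟩ : ↥(cobordantAlgebra f w)) ∈ 𝔞) (hn : 0 < n) :
    algebraMap _ (ChartRing 𝒜 f w dbar y hy) ((⟨_, C_mul_T_mem_cobordantAlgebra _ _ ht⟩ : ↥(cobordantAlgebra f w)) ^ n) * IsLocalization.Away.invSelf (coverElement 𝒜 f w dbar y hy) ∈
        chartNodeGrading mo 𝒜 f w hf0 dbar y hy 0 ∧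
      algebraMap _ (ChartRing 𝒜 f w dbar y hy) ((⟨_, C_mul_T_mem_cobordantAlgebra _ _ ht⟩ : ↥(cobordantAlgebra f w)) ^ n) * IsLocalization.Away.invSelf (coverElement 𝒜 f w dbar y hy) ∈
        𝔞.map (algebraMap _ (ChartRing 𝒜 f w dbar y hy)) := by
  refine ⟨residualSection_mem_chartNodeGrading_zero mo 𝒜 _ _ hf0 y hy ?_, residualSection_mem_map mo 𝒜 _ _ y hy (Ideal.pow_mem_of_mem 𝔞 h𝔞 _ hn)⟩
  have h := qha_tail_pow_mem_reesPiece f t w sh ht mo 𝒜 hf0 h𝒜t n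
  rwa [← hdbar] at h

/-- **The residual set of the two sections is the strict transform**: on `R_c`, a prime containing `u₀′^{n₀}/c` and `t̂^{n}/c` contains `u₀′/1` and `t̂/1`
(`c` is a unit on its chart). -/
theorem mem_of_residualSections_mem (n₀ n : ℕ) (Q : Ideal (ChartRing 𝒜 f w dbar y hy)) [hQ : Q.IsPrime]
    (h0 : algebraMap _ (ChartRing 𝒜 f w dbar y hy) (cobordantAlgebra.u' f w 0 ^ n₀) * IsLocalization.Away.invSelf (coverElement 𝒜 f w dbar y hy) ∈ Q)
    (h1 : algebraMap _ (ChartRing 𝒜 f w dbar y hy) ((⟨_, C_mul_T_mem_cobordantAlgebra _ _ ht⟩ : ↥(cobordantAlgebra f w)) ^ n) * IsLocalization.Away.invSelf (coverElement 𝒜 f w dbar y hy) ∈ Q)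
    (hn₀ : 0 < n₀) (hn : 0 < n) :
    algebraMap _ (ChartRing 𝒜 f w dbar y hy) (cobordantAlgebra.u' f w 0) ∈ Q ∧
      algebraMap _ (ChartRing 𝒜 f w dbar y hy) ((⟨_, C_mul_T_mem_cobordantAlgebra _ _ ht⟩ : ↥(cobordantAlgebra f w))) ∈ Q := by
  have hunit : IsUnit (IsLocalization.Away.invSelf (S := ChartRing 𝒜 f w dbar y hy) (coverElement 𝒜 f w dbar y hy)) := by
    exact IsUnit.of_mul_eq_one (algebraMap _ (ChartRing 𝒜 f w dbar y hy) (coverElement 𝒜 f w dbar y hy))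
      (by rw [mul_comm]; exact IsLocalization.Away.mul_invSelf _)
  have key : ∀ {z : ↥(cobordantAlgebra f w)} {e : ℕ}, 0 < e →
      algebraMap _ (ChartRing 𝒜 f w dbar y hy) (z ^ e) * IsLocalization.Away.invSelf (coverElement 𝒜 f w dbar y hy) ∈ Q →
        algebraMap _ (ChartRing 𝒜 f w dbar y hy) z ∈ Q := fun {z} {e} he h => by
    rcases hQ.mem_or_mem h with hz | hu
    · rw [map_pow] at hz; exact hQ.mem_of_pow_mem _ hz
    · exact absurd (Q.eq_top_of_isUnit_mem hu hunit) hQ.ne_top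
  exact ⟨key hn₀ h0, key hn h1⟩

end Summit.ResolutionOfSingularities.ResolutionOfSingularities.Theorems.WildQuotientResolution.S1.KillCert.QhAbs

end
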